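import Mathlib
import HarnessLib
import Literature.Probability.MarkovChains.MetropolisHastings
import Literature.Probability.MarkovChains.TotalVariation
import Summits.Ventures.LatticeQCDFlow.Exactness.JarzynskiFinite
import Summits.Ventures.LatticeQCDFlow.Exactness.StochasticFlows
import Summits.Ventures.LatticeQCDFlow.Exactness.NCMCExpandedEnsemble
import Summits.Ventures.LatticeQCDFlow.Scaling.StochasticFlows

/-!
# Expanded-ensemble NCMC with SNF layers inside the switch: exact for every step-balanced protocol

HONEST FRAMING: exact (Metropolis-corrected) sampling algorithms for lattice gauge theory;
figures of merit are autocorrelation/cost numbers at stated couplings and volumes; no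
continuum-physics claim.

Venture `LatticeQCDFlow` (cell pub-lqcd), topic `Exactness`; FANOUT row 13 (`eng-snf`, GEN-8).
NEW WORK of the cell (elementary finite sums); nothing is cited as a fact.  Generalises
`Exactness/NCMCExpandedEnsemble.lean` (Markov steps with the Jarzynski increment) to the
STOCHASTIC-NORMALIZING-FLOW protocols of `Exactness/StochasticFlows.lean` (row 30): every step `k`
is a kernel `P k` charged a work increment `ω k x y`, and all that is used is the per-step balance
`StepBalance (S k) (S (k+1)) (P k) (ω k)` — satisfied by Markov steps (`stepBalance_of_isStationary`)
AND by deterministic bijective layers charged the energy change (`stepBalance_perm`; in the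
continuum this is where `− log|det J|` enters).  This is the engine's layered `ncmc-metropolis`
mode (`latflow-snf` ≥ 0.1.9 `snf.ncmc` with `layers=`; test t27 case D: Möbius defect layers inside
the switches, exact against the 2-d U(1) oracle).  Named only: Nilmeier–Crooks–Minh–Chodera 2011
(NCMC), Wu–Köhler–Noé 2020 (stochastic normalizing flows), Caselle–Cellini–Nada–Panero 2022,
Bonanno et al. arXiv:2510.25704.

## Content

* `tiltedRevKernel S S' P ω y x = e^{-S x} P x y e^{-ω x y} / e^{-S' y}` — the TIME REVERSAL of a
  step-balanced step; `tiltedRevKernel_rowsum`: its rows sum to one exactly when the step balance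
  holds (that is what `StepBalance` says); `tiltedRevKernel_of_jarzynski`: for a Markov step with the
  Jarzynski increment it is `Theory2.revKernel` (the `π`-reversal); `tiltedRevKernel_perm`: for a
  bijective layer `σ` charged `S' y − S x` it is the deterministic kernel of the INVERSE layer `σ⁻¹`
  — the reverse switch applies the inverse layers, as the engine does;
* `snfRevTransProb` (product of the reversals along a path), `snf_crooks_unnormalised`
  (`e^{-S 0 (x 0)} Π P e^{-W} = e^{-S n (x n)} Π P̂`, a telescoping identity), `snf_ncmc_pathwise`;
* `snfFwdSwitch` / `snfRevSwitch` / `snfMove` / `snfKernel` on `Bool × X` with the joint weight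
  `ncmcWeight c S` of the parent file; **`snfMove_detailedBalance`**, `snfKernel_sum_eq_one`,
  **`snfKernel_detailedBalance`**, **`snfKernel_isStationary`** — the layered expanded-ensemble
  switch chain leaves `ncmcWeight c S` invariant for EVERY constant `c` and EVERY step-balanced
  protocol (stochastic steps, bijective layers, in any order);
* `sum_snfRevTransProb_to` — the reverse proposal mass into a pinned end is one, from
  `crooks_general` alone; `snfKernel_nonneg` — it is a Markov kernel for non-negative `P k` with unit
  row sums.
-/

namespace Summit.Ventures.LatticeQCDFlow.Exactness

open Finset
open Literature.Probability.MarkovChains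

variable {X : Type*} [Fintype X] [DecidableEq X] {n : ℕ}

/-! ## The time reversal of a step-balanced step -/

/-- Time reversal of one protocol step `(S → S', P, ω)`:
`P̂ y x = e^{-S x} · P x y · e^{-ω x y} / e^{-S' y}`. -/
noncomputable def tiltedRevKernel (S S' : X → ℝ) (P ω : X → X → ℝ) (y x : X) : ℝ :=
  Real.exp (-S x) * P x y * Real.exp (-ω x y) / Real.exp (-S' y)

omit [DecidableEq X] in
/-- Its rows sum to one iff the step balance holds — here the forward direction. -/
theorem tiltedRevKernel_rowsum {S S' : X → ℝ} {P ω : X → X → ℝ} (h : StepBalance S S' P ω) (y : X) :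
    ∑ x, tiltedRevKernel S S' P ω y x = 1 := by
  unfold tiltedRevKernel
  rw [← sum_div, h y, div_self (Real.exp_pos _).ne']

omit [Fintype X] [DecidableEq X] in
/-- It is non-negative for a non-negative step kernel. -/
theorem tiltedRevKernel_nonneg {S S' : X → ℝ} {P ω : X → X → ℝ} (hP : ∀ x y, 0 ≤ P x y) (y x : X) :
    0 ≤ tiltedRevKernel S S' P ω y x :=
  div_nonneg (mul_nonneg (mul_nonneg (Real.exp_pos _).le (hP x y)) (Real.exp_pos _).le)
    (Real.exp_pos _).le

omit [Fintype X] [DecidableEq X] in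
/-- For a MARKOV step charged the Jarzynski increment `ω x y = S' x − S x` the reversal is the
`e^{-S'}`-reversal `Theory2.revKernel` of the parent file's setting. -/
theorem tiltedRevKernel_of_jarzynski (S S' : X → ℝ) (P : X → X → ℝ) (y x : X) :
    tiltedRevKernel S S' P (fun a _ => S' a - S a) y x =
      Theory2.revKernel (fun a => Real.exp (-(S' a))) P y x := by
  unfold tiltedRevKernel Theory2.revKernel
  have h : -S x + -(S' x - S x) = -(S' x) := by ring
  rw [mul_right_comm, ← Real.exp_add, h]

omit [Fintype X] in
/-- For a BIJECTIVE LAYER `σ` charged the energy change `S' y − S x` the reversal is the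
deterministic kernel of the INVERSE layer: `P̂ = permKernel σ⁻¹`. -/
theorem tiltedRevKernel_perm (σ : Equiv.Perm X) (S S' : X → ℝ) (y x : X) :
    tiltedRevKernel S S' (permKernel σ) (fun a b => S' b - S a) y x = permKernel σ.symm y x := by
  unfold tiltedRevKernel permKernel
  by_cases h : y = σ x
  · have hx : x = σ.symm y := by rw [h, Equiv.symm_apply_apply]
    rw [if_pos h, if_pos hx, mul_one, ← Real.exp_add, div_eq_one_iff_eq (Real.exp_pos _).ne']
    congr 1
    ring
  · have hx : ¬x = σ.symm y := fun hx => h (by rw [hx, Equiv.apply_symm_apply])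
    rw [if_neg h, if_neg hx, mul_zero, zero_mul, zero_div]

/-! ## Pathwise Crooks for step-balanced protocols -/

/-- Product of the step reversals along a path (indexed by forward time). -/
noncomputable def snfRevTransProb (S : Fin (n + 1) → X → ℝ) (P ω : Fin n → X → X → ℝ)
    (x : Fin (n + 1) → X) : ℝ :=
  ∏ k : Fin n, tiltedRevKernel (S k.castSucc) (S k.succ) (P k) (ω k) (x k.succ) (x k.castSucc)

omit [Fintype X] [DecidableEq X] in
/-- **Crooks, un-normalised, for step-balanced protocols** (a telescoping identity — the content
is that the reversal is a kernel, `tiltedRevKernel_rowsum`):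
`e^{-S 0 (x 0)} · Π_k P k · e^{-W(x)} = e^{-S n (x n)} · Π_k P̂ k`. -/
theorem snf_crooks_unnormalised (S : Fin (n + 1) → X → ℝ) (P ω : Fin n → X → X → ℝ)
    (x : Fin (n + 1) → X) :
    Real.exp (-S 0 (x 0)) * transProb P x * Real.exp (-(workGen ω x)) =
      Real.exp (-S (Fin.last n) (x (Fin.last n))) * snfRevTransProb S P ω x := by
  have htel : Real.exp (-S 0 (x 0)) * ∏ k : Fin n, Real.exp (-S k.succ (x k.succ)) =
      (∏ k : Fin n, Real.exp (-S k.castSucc (x k.castSucc))) *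
        Real.exp (-S (Fin.last n) (x (Fin.last n))) :=
    (Fin.prod_univ_succ fun i : Fin (n + 1) => Real.exp (-S i (x i))).symm.trans
      (Fin.prod_univ_castSucc fun i : Fin (n + 1) => Real.exp (-S i (x i)))
  have hD : (∏ k : Fin n, Real.exp (-S k.succ (x k.succ))) ≠ 0 :=
    prod_ne_zero_iff.mpr fun k _ => (Real.exp_pos _).ne'
  have hW : Real.exp (-(workGen ω x)) = ∏ k : Fin n, Real.exp (-ω k (x k.castSucc) (x k.succ)) := by
    rw [workGen, ← sum_neg_distrib, Real.exp_sum]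
  have hR : snfRevTransProb S P ω x =
      (∏ k : Fin n, Real.exp (-S k.castSucc (x k.castSucc))) * transProb P x *
        (∏ k : Fin n, Real.exp (-ω k (x k.castSucc) (x k.succ))) /
        ∏ k : Fin n, Real.exp (-S k.succ (x k.succ)) := by
    unfold snfRevTransProb tiltedRevKernel transProb
    rw [prod_div_distrib, prod_mul_distrib, prod_mul_distrib]
  rw [hR, hW, ← mul_div_assoc, eq_div_iff hD]
  calc Real.exp (-S 0 (x 0)) * transProb P x *
        (∏ k : Fin n, Real.exp (-ω k (x k.castSucc) (x k.succ))) *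
        ∏ k : Fin n, Real.exp (-S k.succ (x k.succ))
      = (Real.exp (-S 0 (x 0)) * ∏ k : Fin n, Real.exp (-S k.succ (x k.succ))) *
          transProb P x * ∏ k : Fin n, Real.exp (-ω k (x k.castSucc) (x k.succ)) := by ring
    _ = Real.exp (-S (Fin.last n) (x (Fin.last n))) *
          ((∏ k : Fin n, Real.exp (-S k.castSucc (x k.castSucc))) * transProb P x *
            ∏ k : Fin n, Real.exp (-ω k (x k.castSucc) (x k.succ))) := by rw [htel]; ring

/-- Forward acceptance against `c`: `min 1 e^{-(W − c)}`, `W` the generalized (SNF) work. -/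
noncomputable def snfFwdAcc (c : ℝ) (ω : Fin n → X → X → ℝ) (x : Fin (n + 1) → X) : ℝ :=
  min 1 (Real.exp (-(workGen ω x - c)))

/-- Reverse acceptance (reverse generalized work `−W`): `min 1 e^{W − c}`. -/
noncomputable def snfRevAcc (c : ℝ) (ω : Fin n → X → X → ℝ) (x : Fin (n + 1) → X) : ℝ :=
  min 1 (Real.exp (workGen ω x - c))

omit [Fintype X] [DecidableEq X] in
/-- **Pathwise balance of the layered switch**, for every path and every `c`. -/
theorem snf_ncmc_pathwise (c : ℝ) (S : Fin (n + 1) → X → ℝ) (P ω : Fin n → X → X → ℝ)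
    (x : Fin (n + 1) → X) :
    Real.exp (-S 0 (x 0)) * transProb P x * snfFwdAcc c ω x =
      Real.exp c * Real.exp (-S (Fin.last n) (x (Fin.last n))) * snfRevTransProb S P ω x *
        snfRevAcc c ω x := by
  have key := snf_crooks_unnormalised S P ω x
  have h1 : snfFwdAcc c ω x = Real.exp (-(workGen ω x)) * min (Real.exp (workGen ω x)) (Real.exp c) := by
    unfold snfFwdAcc
    rw [mul_min_of_nonneg _ _ (Real.exp_pos _).le, ← Real.exp_add, ← Real.exp_add, neg_add_cancel,
      Real.exp_zero]
    congr 1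
    congr 1
    ring
  have h2 : Real.exp c * snfRevAcc c ω x = min (Real.exp (workGen ω x)) (Real.exp c) := by
    unfold snfRevAcc
    rw [mul_min_of_nonneg _ _ (Real.exp_pos _).le, mul_one, ← Real.exp_add, min_comm]
    congr 1
    congr 1
    ring
  calc Real.exp (-S 0 (x 0)) * transProb P x * snfFwdAcc c ω x
      = (Real.exp (-S 0 (x 0)) * transProb P x * Real.exp (-(workGen ω x))) *
          min (Real.exp (workGen ω x)) (Real.exp c) := by rw [h1]; ring
    _ = (Real.exp (-S (Fin.last n) (x (Fin.last n))) * snfRevTransProb S P ω x) *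
          (Real.exp c * snfRevAcc c ω x) := by rw [key, h2]
    _ = Real.exp c * Real.exp (-S (Fin.last n) (x (Fin.last n))) * snfRevTransProb S P ω x *
          snfRevAcc c ω x := by ring

/-! ## The layered switch kernel and its invariance -/

/-- Accepted forward switch weight (prior → target) over step-balanced paths from `x` to `y`. -/
noncomputable def snfFwdSwitch (c : ℝ) (P ω : Fin n → X → X → ℝ) (x y : X) : ℝ :=
  ∑ p : Fin (n + 1) → X,
    if p 0 = x ∧ p (Fin.last n) = y then transProb P p * snfFwdAcc c ω p else 0

/-- Accepted reverse switch weight (target → prior): reversed steps — adjoint kernels and INVERSE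
layers — down the protocol, accepted with `min 1 e^{W − c}`. -/
noncomputable def snfRevSwitch (c : ℝ) (S : Fin (n + 1) → X → ℝ) (P ω : Fin n → X → X → ℝ)
    (y x : X) : ℝ :=
  ∑ p : Fin (n + 1) → X,
    if p 0 = x ∧ p (Fin.last n) = y then snfRevTransProb S P ω p * snfRevAcc c ω p else 0

/-- Accepted moves of the layered expanded-ensemble chain on `Bool × X`. -/
noncomputable def snfMove (c : ℝ) (S : Fin (n + 1) → X → ℝ) (P ω : Fin n → X → X → ℝ) :
    Bool × X → Bool × X → ℝ
  | (false, x), (true, y) => snfFwdSwitch c P ω x y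
  | (true, y), (false, x) => snfRevSwitch c S P ω y x
  | _, _ => 0

/-- The full layered switch kernel (rejected mass on the diagonal). -/
noncomputable def snfKernel (c : ℝ) (S : Fin (n + 1) → X → ℝ) (P ω : Fin n → X → X → ℝ)
    (s s' : Bool × X) : ℝ :=
  snfMove c S P ω s s' + if s' = s then 1 - ∑ t, snfMove c S P ω s t else 0

/-- Between the levels: `e^{-S 0 x} · F(x → y) = e^{c} e^{-S n y} · R(y → x)`. -/
theorem snfFwdSwitch_balance (c : ℝ) (S : Fin (n + 1) → X → ℝ) (P ω : Fin n → X → X → ℝ)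
    (x y : X) :
    Real.exp (-S 0 x) * snfFwdSwitch c P ω x y =
      Real.exp c * Real.exp (-S (Fin.last n) y) * snfRevSwitch c S P ω y x := by
  unfold snfFwdSwitch snfRevSwitch
  rw [mul_sum, mul_sum]
  refine sum_congr rfl fun p _ => ?_
  by_cases h : p 0 = x ∧ p (Fin.last n) = y
  · rw [if_pos h, if_pos h, ← h.1, ← h.2, ← mul_assoc, snf_ncmc_pathwise c S P ω p]
    ring
  · rw [if_neg h, if_neg h, mul_zero, mul_zero]

/-- **Detailed balance of the layered accepted moves** w.r.t. `ncmcWeight c S`, every `c`. -/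
theorem snfMove_detailedBalance (c : ℝ) (S : Fin (n + 1) → X → ℝ) (P ω : Fin n → X → X → ℝ) :
    DetailedBalance (ncmcWeight c S) (snfMove c S P ω) := by
  rintro ⟨b, x⟩ ⟨b', y⟩
  cases b <;> cases b'
  · simp [snfMove]
  · simp only [ncmcWeight, snfMove]
    exact snfFwdSwitch_balance c S P ω x y
  · simp only [ncmcWeight, snfMove]
    exact (snfFwdSwitch_balance c S P ω y x).symm
  · simp [snfMove]

/-- Unit row sums. -/
theorem snfKernel_sum_eq_one (c : ℝ) (S : Fin (n + 1) → X → ℝ) (P ω : Fin n → X → X → ℝ)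
    (s : Bool × X) : ∑ s', snfKernel c S P ω s s' = 1 := by
  unfold snfKernel
  rw [sum_add_distrib, sum_ite_eq' univ s, if_pos (mem_univ s)]
  ring

/-- **Detailed balance of the layered switch kernel.** -/
theorem snfKernel_detailedBalance (c : ℝ) (S : Fin (n + 1) → X → ℝ) (P ω : Fin n → X → X → ℝ) :
    DetailedBalance (ncmcWeight c S) (snfKernel c S P ω) := by
  intro s s'
  unfold snfKernel
  have hM := snfMove_detailedBalance c S P ω s s'
  by_cases hss : s' = s
  · subst hss
    rfl
  · have hss' : ¬s = s' := fun h => hss h.symm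
    rw [if_neg hss, if_neg hss', add_zero, add_zero]
    exact hM

/-- **Exactness of the layered expanded-ensemble NCMC chain**: `ncmcWeight c S` is invariant for
EVERY constant `c` and EVERY protocol of kernels and work increments — the statement is purely
algebraic in `(S, P, ω)`; the step balance enters only to make the reverse move a genuine proposal
kernel (`tiltedRevKernel_rowsum`, `sum_snfRevTransProb_to`, `snfKernel_nonneg`). -/
theorem snfKernel_isStationary (c : ℝ) (S : Fin (n + 1) → X → ℝ) (P ω : Fin n → X → X → ℝ) :
    IsStationary (ncmcWeight c S) (snfKernel c S P ω) :=
  (snfKernel_detailedBalance c S P ω).isStationary (snfKernel_sum_eq_one c S P ω)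

/-! ## It is a Markov kernel (step balance) -/

omit [Fintype X] [DecidableEq X] in
/-- Acceptances lie in `[0, 1]`. -/
theorem snfFwdAcc_mem (c : ℝ) (ω : Fin n → X → X → ℝ) (x : Fin (n + 1) → X) :
    0 ≤ snfFwdAcc c ω x ∧ snfFwdAcc c ω x ≤ 1 :=
  ⟨le_min zero_le_one (Real.exp_pos _).le, min_le_left _ _⟩

omit [Fintype X] [DecidableEq X] in
/-- Acceptances lie in `[0, 1]`. -/
theorem snfRevAcc_mem (c : ℝ) (ω : Fin n → X → X → ℝ) (x : Fin (n + 1) → X) :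
    0 ≤ snfRevAcc c ω x ∧ snfRevAcc c ω x ≤ 1 :=
  ⟨le_min zero_le_one (Real.exp_pos _).le, min_le_left _ _⟩

/-- The reverse proposal mass into a pinned end is one, from the step balance alone
(`crooks_general` with the indicator of `y`). -/
theorem sum_snfRevTransProb_to (S : Fin (n + 1) → X → ℝ) (P ω : Fin n → X → X → ℝ)
    (hb : ∀ k : Fin n, StepBalance (S k.castSucc) (S k.succ) (P k) (ω k)) (y : X) :
    ∑ p : Fin (n + 1) → X, (if p (Fin.last n) = y then snfRevTransProb S P ω p else 0) = 1 := by
  have hJ := crooks_general S P ω hb (fun z => if z = y then Real.exp (S (Fin.last n) y) else 0)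
  simp only [mul_ite, mul_zero, Finset.sum_ite_eq', Finset.mem_univ, if_true] at hJ
  rw [← Real.exp_add, neg_add_cancel, Real.exp_zero] at hJ
  rw [← hJ]
  refine sum_congr rfl fun p _ => ?_
  by_cases h : p (Fin.last n) = y
  · rw [if_pos h, if_pos h, snf_crooks_unnormalised S P ω p, h,
      mul_comm (Real.exp (-S (Fin.last n) y)), mul_assoc, ← Real.exp_add, neg_add_cancel,
      Real.exp_zero, mul_one]
  · rw [if_neg h, if_neg h]

/-- The accepted forward mass out of `x` is at most one (unit row sums of the `P k`). -/
theorem sum_snfFwdSwitch_le_one (c : ℝ) (P ω : Fin n → X → X → ℝ)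
    (hP0 : ∀ k x y, 0 ≤ P k x y) (hP1 : ∀ k x, ∑ y, P k x y = 1) (x : X) :
    ∑ y, snfFwdSwitch c P ω x y ≤ 1 := by
  have h1 : ∑ p : Fin (n + 1) → X, (if p 0 = x then transProb P p else 0) = 1 := by
    have h := sum_pathLaw (fun x' => if x' = x then (1 : ℝ) else 0) P hP1
    rw [sum_ite_eq' univ x, if_pos (mem_univ x)] at h
    rw [← h]
    refine sum_congr rfl fun p _ => ?_
    unfold pathLaw
    by_cases h0 : p 0 = x
    · simp only [h0, if_true, one_mul]
    · simp only [h0, if_false, zero_mul]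
  calc ∑ y, snfFwdSwitch c P ω x y
      = ∑ p : Fin (n + 1) → X, (if p 0 = x then transProb P p * snfFwdAcc c ω p else 0) := by
        unfold snfFwdSwitch
        rw [sum_comm]
        refine sum_congr rfl fun p _ => ?_
        by_cases h0 : p 0 = x
        · rw [if_pos h0]
          simp only [h0, true_and]
          rw [sum_ite_eq univ (p (Fin.last n)), if_pos (mem_univ _)]
        · rw [if_neg h0]
          exact sum_eq_zero fun y _ => if_neg fun h => h0 h.1
    _ ≤ ∑ p : Fin (n + 1) → X, (if p 0 = x then transProb P p else 0) := by
        refine sum_le_sum fun p _ => ?_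
        split_ifs
        · have hT : 0 ≤ transProb P p := prod_nonneg fun k _ => hP0 k _ _
          calc transProb P p * snfFwdAcc c ω p ≤ transProb P p * 1 :=
                mul_le_mul_of_nonneg_left (snfFwdAcc_mem c ω p).2 hT
            _ = transProb P p := mul_one _
        · exact le_rfl
    _ = 1 := h1

/-- The accepted reverse mass out of `y` is at most one (step balance). -/
theorem sum_snfRevSwitch_le_one (c : ℝ) (S : Fin (n + 1) → X → ℝ) (P ω : Fin n → X → X → ℝ)
    (hP0 : ∀ k x y, 0 ≤ P k x y)
    (hb : ∀ k : Fin n, StepBalance (S k.castSucc) (S k.succ) (P k) (ω k)) (y : X) :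
    ∑ x, snfRevSwitch c S P ω y x ≤ 1 := by
  have hR : ∀ p : Fin (n + 1) → X, 0 ≤ snfRevTransProb S P ω p := fun p =>
    prod_nonneg fun k _ => tiltedRevKernel_nonneg (hP0 k) _ _
  calc ∑ x, snfRevSwitch c S P ω y x
      = ∑ p : Fin (n + 1) → X,
          (if p (Fin.last n) = y then snfRevTransProb S P ω p * snfRevAcc c ω p else 0) := by
        unfold snfRevSwitch
        rw [sum_comm]
        refine sum_congr rfl fun p _ => ?_
        by_cases hn : p (Fin.last n) = y
        · rw [if_pos hn]
          simp only [hn, and_true]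
          rw [sum_ite_eq univ (p 0), if_pos (mem_univ _)]
        · rw [if_neg hn]
          exact sum_eq_zero fun x _ => if_neg fun h => hn h.2
    _ ≤ ∑ p : Fin (n + 1) → X, (if p (Fin.last n) = y then snfRevTransProb S P ω p else 0) := by
        refine sum_le_sum fun p _ => ?_
        split_ifs
        · calc snfRevTransProb S P ω p * snfRevAcc c ω p ≤ snfRevTransProb S P ω p * 1 :=
                mul_le_mul_of_nonneg_left (snfRevAcc_mem c ω p).2 (hR p)
            _ = snfRevTransProb S P ω p := mul_one _
        · exact le_rfl
    _ = 1 := sum_snfRevTransProb_to S P ω hb y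

/-- Accepted-move weights are non-negative. -/
theorem snfMove_nonneg (c : ℝ) (S : Fin (n + 1) → X → ℝ) (P ω : Fin n → X → X → ℝ)
    (hP0 : ∀ k x y, 0 ≤ P k x y) (s s' : Bool × X) : 0 ≤ snfMove c S P ω s s' := by
  have hT : ∀ p : Fin (n + 1) → X, 0 ≤ transProb P p := fun p => prod_nonneg fun k _ => hP0 k _ _
  have hR : ∀ p : Fin (n + 1) → X, 0 ≤ snfRevTransProb S P ω p := fun p =>
    prod_nonneg fun k _ => tiltedRevKernel_nonneg (hP0 k) _ _
  rcases s with ⟨b, x⟩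
  rcases s' with ⟨b', y⟩
  cases b <;> cases b' <;> simp only [snfMove]
  · exact le_rfl
  · exact sum_nonneg fun p _ => by
      split_ifs
      · exact mul_nonneg (hT p) (snfFwdAcc_mem c ω p).1
      · exact le_rfl
  · exact sum_nonneg fun p _ => by
      split_ifs
      · exact mul_nonneg (hR p) (snfRevAcc_mem c ω p).1
      · exact le_rfl
  · exact le_rfl

/-- **The layered switch kernel is a Markov kernel**: non-negative entries for non-negative,
row-stochastic step kernels satisfying the step balance (unit row sums: `snfKernel_sum_eq_one`). -/
theorem snfKernel_nonneg (c : ℝ) (S : Fin (n + 1) → X → ℝ) (P ω : Fin n → X → X → ℝ)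
    (hP0 : ∀ k x y, 0 ≤ P k x y) (hP1 : ∀ k x, ∑ y, P k x y = 1)
    (hb : ∀ k : Fin n, StepBalance (S k.castSucc) (S k.succ) (P k) (ω k)) (s s' : Bool × X) :
    0 ≤ snfKernel c S P ω s s' := by
  unfold snfKernel
  have hm := snfMove_nonneg c S P ω hP0 s s'
  split_ifs with h
  · subst h
    have hrow : ∑ t, snfMove c S P ω s' t ≤ 1 := by
      rcases s' with ⟨b, x⟩
      rw [Fintype.sum_prod_type, Fintype.sum_bool]
      cases b
      · simp only [snfMove, sum_const_zero, add_zero]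
        exact sum_snfFwdSwitch_le_one c P ω hP0 hP1 x
      · simp only [snfMove, sum_const_zero, zero_add]
        exact sum_snfRevSwitch_le_one c S P ω hP0 hb x
    linarith
  · rw [add_zero]
    exact hm

end Summit.Ventures.LatticeQCDFlow.Exactness
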